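import Literature.Analysis.FluidPDE.DoeringFoiasAmplitudeProofs

/-!
# Doering–Foias amplitude bound from an INTEGRATED convective bound (negative side of `GPMeanBoundedFamily`)

cdisprove seat `refuter-cdisprove-stmt-AnomalousDissipation-15509-0` (stmt-AnomalousDissipation-15509, cycle 1).
Tool file for `Negative/LevelFloorExplicit.lean`: the in-tree `abs_amplitude_mul_le_of_isGlobalLerayHopf` /
`DoeringFoias.abs_amplitude_le_of_isGlobalLerayHopf` (Cheskidov–Doering–Petrov 2007 eq. (18)) with the crude
hypothesis `∑ᵢ‖∂ᵢΨ‖ ≤ C` replaced by an integrated convective bound `|∫⟪U,(U·∇)Ψ⟫| ≤ C ∫‖U‖²` for all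
`U ∈ L²` (proofs otherwise verbatim), so that force-specific SHARP convective constants can be fed in.
-/

noncomputable section

open MeasureTheory Filter Set Function Topology
open scoped RealInnerProductSpace ENNReal NNReal

namespace Summit.AnomalousDissipation.AnomalousDissipation.Theorems.GPMeanBoundedFamily.Negative

open Literature.Analysis Literature.Analysis.FunctionSpaces Literature.Analysis.FluidPDE

/-! ### Doering–Foias amplitude bound from an integrated convective bound (any forcing shape) -/

section IntegralBounds

variable {d : Type*} [Fintype d] [DecidableEq d]
variable {ν : ℝ} {Φ : ForcingShape d} {n : ℕ} {F : ℝ}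
  {u : ℝ → UnitAddTorus d → EuclideanSpace ℝ d} {u₀ : UnitAddTorus d → EuclideanSpace ℝ d}

/-- Pointwise-in-time amplitude bound (Cheskidov–Doering–Petrov 2007 eq. (18)) with an INTEGRATED convective
hypothesis `|∫⟪U,(U·∇)Ψ⟫| ≤ C∫‖U‖²` in place of `∑ᵢ‖∂ᵢΨ‖ ≤ C`:
`|F| t ≤ KP (E(t))^{1/2} + |⟨u₀,Ψ⟩| + C ∫₀ᵗ E + |ν| KL ∫₀ᵗ √E`. [cite: CheskidovDoeringPetrov2006, §III eq. (18)] -/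
theorem abs_amplitude_mul_le_of_integralBounds (hn : 0 < n)
    (hu : Torus.IsGlobalLerayHopf ν (fun _ => Φ.force n F) u₀ u)
    {KP C KL : ℝ} (hKP : 0 ≤ KP) (hKL : 0 ≤ KL) (hP : ∀ x, ‖Φ.force n 1 x‖ ≤ KP)
    (hconv : ∀ U : UnitAddTorus d → EuclideanSpace ℝ d, MemLp U 2 volume →
      |∫ x, ⟪U x, Torus.convect U (Φ.force n 1) x⟫| ≤ C * ∫ x, ‖U x‖ ^ 2)
    (hL : ∀ x, ‖Torus.laplacian (Φ.force n 1) x‖ ≤ KL) {t : ℝ} (ht : 0 < t) :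
    |F| * t ≤ KP * Real.sqrt (∫ x, ‖u t x‖ ^ 2) + |∫ x, ⟪u₀ x, Φ.force n 1 x⟫| +
      C * (∫ s in Ioc 0 t, ∫ x, ‖u s x‖ ^ 2) +
        |ν| * KL * ∫ s in Ioc 0 t, Real.sqrt (∫ x, ‖u s x‖ ^ 2) := by
  set Ψ := Φ.force n 1 with hΨdef
  have hid := amplitude_mul_eq_of_isGlobalLerayHopf hn hu ht
  have hE := hu.integrableOn_integral_norm_sq ht
  have hsqE := hu.integrableOn_sqrt_integral_norm_sq ht
  have b1 : |∫ x, ⟪u t x, Ψ x⟫| ≤ KP * Real.sqrt (∫ x, ‖u t x‖ ^ 2) := by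
    have hm := hu.memLp_two ht.le
    exact (Torus.abs_integral_inner_le_of_norm_le (hm.integrable one_le_two) hP).trans
      (mul_le_mul_of_nonneg_left (integral_norm_le_sqrt_integral_norm_sq hm) hKP)
  have b3 : |∫ s in Ioc 0 t, ∫ x, ⟪u s x, Torus.convect (u s) Ψ x⟫| ≤
      C * ∫ s in Ioc 0 t, ∫ x, ‖u s x‖ ^ 2 := by
    rw [← integral_const_mul]
    refine abs_integral_le_integral_abs.trans (integral_mono_of_nonneg
      (ae_of_all _ fun s => abs_nonneg _) (hE.const_mul C) ?_)
    filter_upwards [ae_restrict_mem measurableSet_Ioc] with s hs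
    exact hconv (u s) (hu.memLp_two hs.1.le)
  have b4 : |∫ s in Ioc 0 t, ∫ x, ⟪u s x, Torus.laplacian Ψ x⟫| ≤
      KL * ∫ s in Ioc 0 t, Real.sqrt (∫ x, ‖u s x‖ ^ 2) := by
    rw [← integral_const_mul]
    refine abs_integral_le_integral_abs.trans (integral_mono_of_nonneg
      (ae_of_all _ fun s => abs_nonneg _) (hsqE.const_mul KL) ?_)
    filter_upwards [ae_restrict_mem measurableSet_Ioc] with s hs
    have hm := hu.memLp_two hs.1.le
    exact (Torus.abs_integral_inner_le_of_norm_le (hm.integrable one_le_two) hL).trans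
      (mul_le_mul_of_nonneg_left (integral_norm_le_sqrt_integral_norm_sq hm) hKL)
  have b4' : |ν * ∫ s in Ioc 0 t, ∫ x, ⟪u s x, Torus.laplacian Ψ x⟫| ≤
      |ν| * KL * ∫ s in Ioc 0 t, Real.sqrt (∫ x, ‖u s x‖ ^ 2) := by
    rw [abs_mul, mul_assoc]
    exact mul_le_mul_of_nonneg_left b4 (abs_nonneg ν)
  have habs : |F| * t = |F * t| := by rw [abs_mul, abs_of_pos ht]
  rw [habs, hid]
  calc |(∫ x, ⟪u t x, Ψ x⟫) - (∫ x, ⟪u₀ x, Ψ x⟫) -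
        (∫ s in Ioc 0 t, ∫ x, ⟪u s x, Torus.convect (u s) Ψ x⟫) -
          ν * ∫ s in Ioc 0 t, ∫ x, ⟪u s x, Torus.laplacian Ψ x⟫|
      ≤ |∫ x, ⟪u t x, Ψ x⟫| + |∫ x, ⟪u₀ x, Ψ x⟫| +
          |∫ s in Ioc 0 t, ∫ x, ⟪u s x, Torus.convect (u s) Ψ x⟫| +
            |ν * ∫ s in Ioc 0 t, ∫ x, ⟪u s x, Torus.laplacian Ψ x⟫| := by
        refine (abs_sub _ _).trans (add_le_add ((abs_sub _ _).trans (add_le_add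
          (abs_sub _ _) le_rfl)) le_rfl)
    _ ≤ _ := by linarith

/-- **Doering–Foias amplitude bound from an integrated convective bound**: for a global Leray–Hopf solution
on `T^d` driven by `F Φ(n • ·)`, `ν > 0`, `0 < n`, with `|∫⟪U,(U·∇)Ψ⟫| ≤ C∫‖U‖²` for all `U ∈ L²` and
`‖ΔΨ‖ ≤ KL` (`Ψ = Φ(n • ·)`): `|F| ≤ C U² + ν KL U`, `U = ⟨‖u‖₂²⟩^{1/2}` (the proof of
`DoeringFoias.abs_amplitude_le_of_isGlobalLerayHopf`, verbatim but for the convective step).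
[cite: CheskidovDoeringPetrov2006, §III eq. (18)] -/
theorem abs_amplitude_le_of_integralBounds (hν : 0 < ν) (hn : 0 < n)
    (hu : Torus.IsGlobalLerayHopf ν (fun _ => Φ.force n F) u₀ u) {C KL : ℝ} (hC : 0 ≤ C)
    (hKL : 0 ≤ KL)
    (hconv : ∀ U : UnitAddTorus d → EuclideanSpace ℝ d, MemLp U 2 volume →
      |∫ x, ⟪U x, Torus.convect U (Φ.force n 1) x⟫| ≤ C * ∫ x, ‖U x‖ ^ 2)
    (hL : ∀ x, ‖Torus.laplacian (Φ.force n 1) x‖ ≤ KL) :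
    |F| ≤ C * rmsVelocity longTimeAvgSup u ^ 2 + ν * KL * rmsVelocity longTimeAvgSup u := by
  obtain ⟨hΨ, -, -⟩ := ForcingShape.force_regular_holds Φ hn (1 : ℝ)
  obtain ⟨KP, hKP, hP⟩ := Torus.exists_nonneg_forall_norm_le_of_continuous hΨ.continuous
  have hU0 : 0 ≤ rmsVelocity longTimeAvgSup u := Real.sqrt_nonneg _
  have hE0 : ∀ s, 0 ≤ ∫ x, ‖u s x‖ ^ 2 := fun s => integral_nonneg fun x => sq_nonneg _
  have heb : IsBoundedUnder (· ≤ ·) atTop (timeMean fun s => ∫ x, ‖u s x‖ ^ 2) :=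
    isBoundedUnder_of_eventually_le (eventually_atTop.2 ⟨1, fun t ht =>
      hu.timeMean_norm_sq_le hν (Φ.isSmooth_force hn F) (Φ.hasZeroMean_force hn F) ht⟩)
  have heU : limsup (timeMean fun s => ∫ x, ‖u s x‖ ^ 2) atTop = rmsVelocity longTimeAvgSup u ^ 2 := by
    rw [rmsVelocity, Real.sq_sqrt (meanEnergy_nonneg u)]
    rfl
  obtain ⟨B, hB⟩ := heb
  rw [Filter.eventually_map] at hB
  have hIS : ∀ t, 0 < t → (∫ s in Ioc 0 t, Real.sqrt (∫ x, ‖u s x‖ ^ 2)) ≤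
      t * Real.sqrt (timeMean (fun s => ∫ x, ‖u s x‖ ^ 2) t) := by
    intro t ht
    have hJ := timeMean_sqrt_le_sqrt_timeMean ht hE0 (hu.integrableOn_integral_norm_sq ht)
    rw [timeMean, intervalIntegral.integral_of_le ht.le] at hJ
    have h2 := mul_le_mul_of_nonneg_left hJ ht.le
    rwa [← mul_assoc, mul_inv_cancel₀ ht.ne', one_mul] at h2
  have hIE : ∀ t, 0 < t → (∫ s in Ioc 0 t, ∫ x, ‖u s x‖ ^ 2) =
      t * timeMean (fun s => ∫ x, ‖u s x‖ ^ 2) t := by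
    intro t ht
    rw [timeMean, intervalIntegral.integral_of_le ht.le, ← mul_assoc, mul_inv_cancel₀ ht.ne',
      one_mul]
  have hstep : ∀ t, 0 < t → |F| ≤ KP * Real.sqrt (∫ x, ‖u t x‖ ^ 2) / t +
      |∫ x, ⟪u₀ x, Φ.force n 1 x⟫| / t + C * timeMean (fun s => ∫ x, ‖u s x‖ ^ 2) t +
        |ν| * KL * Real.sqrt (timeMean (fun s => ∫ x, ‖u s x‖ ^ 2) t) := by
    intro t ht
    have h := abs_amplitude_mul_le_of_integralBounds hn hu hKP hKL hP hconv hL ht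
    rw [hIE t ht] at h
    have h3 := mul_le_mul_of_nonneg_left (hIS t ht) (mul_nonneg (abs_nonneg ν) hKL)
    have h' : |F| * t ≤ KP * Real.sqrt (∫ x, ‖u t x‖ ^ 2) + |∫ x, ⟪u₀ x, Φ.force n 1 x⟫| +
        C * (t * timeMean (fun s => ∫ x, ‖u s x‖ ^ 2) t) +
          |ν| * KL * (t * Real.sqrt (timeMean (fun s => ∫ x, ‖u s x‖ ^ 2) t)) := by
      linarith
    rw [← le_div_iff₀ ht] at h'
    refine h'.trans_eq ?_
    field_simp
  have hgrowth : ∀ᶠ t in atTop, ∫ x, ‖u t x‖ ^ 2 ≤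
      (∫ x, ‖u₀ x‖ ^ 2) + (2 * |F| * KP * Real.sqrt (max B 0)) * t := by
    filter_upwards [hB, eventually_gt_atTop (0 : ℝ)] with t hBt ht
    have h := integral_norm_sq_le_of_isGlobalLerayHopf hν.le hu hKP hP ht
    have h2 : Real.sqrt (timeMean (fun s => ∫ x, ‖u s x‖ ^ 2) t) ≤ Real.sqrt (max B 0) :=
      Real.sqrt_le_sqrt (hBt.trans (le_max_left _ _))
    have h3 : (∫ s in Ioc 0 t, Real.sqrt (∫ x, ‖u s x‖ ^ 2)) ≤ t * Real.sqrt (max B 0) :=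
      (hIS t ht).trans (mul_le_mul_of_nonneg_left h2 ht.le)
    have h4 := mul_le_mul_of_nonneg_left h3 (by positivity : 0 ≤ 2 * |F| * KP)
    linarith
  have hvanish : Tendsto (fun t => KP * Real.sqrt ((∫ x, ‖u₀ x‖ ^ 2) +
      (2 * |F| * KP * Real.sqrt (max B 0)) * t) / t + |∫ x, ⟪u₀ x, Φ.force n 1 x⟫| / t)
      atTop (𝓝 0) := by
    have h1 := (tendsto_sqrt_add_mul_div_atTop (∫ x, ‖u₀ x‖ ^ 2)
      (2 * |F| * KP * Real.sqrt (max B 0))).const_mul KP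
    have h2 := (tendsto_inv_atTop_zero : Tendsto (fun r : ℝ => r⁻¹) atTop (𝓝 0)).const_mul
      |∫ x, ⟪u₀ x, Φ.force n 1 x⟫|
    rw [mul_zero] at h1 h2
    have h := h1.add h2
    rw [add_zero] at h
    refine h.congr' ?_
    filter_upwards [eventually_gt_atTop (0 : ℝ)] with t ht
    simp only [div_eq_mul_inv]
    ring
  have key : ∀ δ, 0 < δ → |F| ≤ δ + C * (rmsVelocity longTimeAvgSup u ^ 2 + δ) +
      |ν| * KL * Real.sqrt (rmsVelocity longTimeAvgSup u ^ 2 + δ) := by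
    intro δ hδ
    have heδ : ∀ᶠ t in atTop, timeMean (fun s => ∫ x, ‖u s x‖ ^ 2) t <
        rmsVelocity longTimeAvgSup u ^ 2 + δ :=
      eventually_lt_of_limsup_lt (by rw [heU]; linarith) ⟨B, Filter.eventually_map.mpr hB⟩
    have hvδ := hvanish.eventually (gt_mem_nhds hδ)
    obtain ⟨t, ht0, hgt, het, hvt⟩ :=
      ((eventually_gt_atTop (0 : ℝ)).and (hgrowth.and (heδ.and hvδ))).exists
    have h1 : KP * Real.sqrt (∫ x, ‖u t x‖ ^ 2) / t ≤
        KP * Real.sqrt ((∫ x, ‖u₀ x‖ ^ 2) + (2 * |F| * KP * Real.sqrt (max B 0)) * t) / t :=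
      div_le_div_of_nonneg_right (mul_le_mul_of_nonneg_left (Real.sqrt_le_sqrt hgt) hKP) ht0.le
    have h2 : C * timeMean (fun s => ∫ x, ‖u s x‖ ^ 2) t ≤
        C * (rmsVelocity longTimeAvgSup u ^ 2 + δ) := mul_le_mul_of_nonneg_left het.le hC
    have h3 : |ν| * KL * Real.sqrt (timeMean (fun s => ∫ x, ‖u s x‖ ^ 2) t) ≤
        |ν| * KL * Real.sqrt (rmsVelocity longTimeAvgSup u ^ 2 + δ) :=
      mul_le_mul_of_nonneg_left (Real.sqrt_le_sqrt het.le) (mul_nonneg (abs_nonneg ν) hKL)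
    linarith [hstep t ht0]
  have hcont : Continuous fun δ : ℝ => δ + C * (rmsVelocity longTimeAvgSup u ^ 2 + δ) +
      |ν| * KL * Real.sqrt (rmsVelocity longTimeAvgSup u ^ 2 + δ) :=
    (continuous_id.add (continuous_const.mul (continuous_const.add continuous_id))).add
      (continuous_const.mul ((continuous_const.add continuous_id).sqrt))
  have h0 : (fun δ : ℝ => δ + C * (rmsVelocity longTimeAvgSup u ^ 2 + δ) +
      |ν| * KL * Real.sqrt (rmsVelocity longTimeAvgSup u ^ 2 + δ)) 0 =
      C * rmsVelocity longTimeAvgSup u ^ 2 + ν * KL * rmsVelocity longTimeAvgSup u := by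
    simp [Real.sqrt_sq hU0, abs_of_pos hν]
  rw [← h0]
  have hlim : Tendsto (fun δ : ℝ => δ + C * (rmsVelocity longTimeAvgSup u ^ 2 + δ) +
      |ν| * KL * Real.sqrt (rmsVelocity longTimeAvgSup u ^ 2 + δ)) (𝓝[>] 0)
      (𝓝 ((fun δ : ℝ => δ + C * (rmsVelocity longTimeAvgSup u ^ 2 + δ) +
        |ν| * KL * Real.sqrt (rmsVelocity longTimeAvgSup u ^ 2 + δ)) 0)) :=
    (hcont.tendsto 0).mono_left nhdsWithin_le_nhds
  exact ge_of_tendsto hlim (by filter_upwards [self_mem_nhdsWithin] with δ hδ using key δ hδ)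

end IntegralBounds

end Summit.AnomalousDissipation.AnomalousDissipation.Theorems.GPMeanBoundedFamily.Negative
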